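import Summits.Ventures.PercRepro.Antipodal
import Summits.Ventures.PercRepro.Cross3
import Summits.Ventures.PercRepro.AntipodalSMCA

/-!
# The antipodal SMC principle, part B (p6, gen 3; split for the 400-line lint)

Continuation of `AntipodalSMCA.lean` (same namespace): the kernel lemmas (`sum_kernel_compl_nonneg`), the
classification of `Setoid (Fin 3)` (`Setoid.fin3_cases`), the pair-sum kernel is SMC on all comparable pairs
(`crossKernel_cross3_second_difference`), **`LemmaB3Abstract_holds`**, `C004abstract_holds`, `C004_holds_antipodal`,
and `MultiGraph.antipodal_criterion_of_smc` / `sum_compl_nonneg_of_smc`.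
-/

namespace PercRepro
open Finset


/-! ### Kernels on a preorder composed with a monotone map of the cube -/

section Kernel

variable {E : Type*} [Fintype E] [DecidableEq E] {P : Type*} [Preorder P]

omit [Fintype E] in
/-- Closing an edge is below opening it. -/
theorem update_false_le_update_true (η : Config E) (e : E) :
    Function.update η e false ≤ Function.update η e true := by
  intro e'
  by_cases h : e' = e
  · subst h
    simp
  · simp [Function.update_of_ne h]

/-- **Antipodal sums of monotone maps**: for a monotone `c : Config E → P` and a kernel `A` on `P`
with nonnegative diagonal and nonpositive second differences on comparable pairs
(`A b b' - A b a' - A a b' + A a a' ≤ 0` for `a ≤ b`, `a' ≤ b'`), `Σ_σ A(c σ, c σᶜ) ≥ 0`. -/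
theorem sum_kernel_compl_nonneg {c : Config E → P} (hc : Monotone c) (A : P → P → ℝ)
    (hdiag : ∀ a, 0 ≤ A a a)
    (hA : ∀ a b a' b' : P, a ≤ b → a' ≤ b' → A b b' - A b a' - A a b' + A a a' ≤ 0) :
    0 ≤ ∑ σ : Config E, A (c σ) (c σᶜ) :=
  sum_compl_nonneg_of_second_difference (fun ω ω' => A (c ω) (c ω')) (fun ω => hdiag (c ω))
    (fun e η η' => hA _ _ _ _ (hc (update_false_le_update_true η e))
      (hc (update_false_le_update_true η' e)))

end Kernel

/-! ### The partitions of three indices: classification and the pair-sum kernel -/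

section Fin3

/-- The one-block and the discrete partition of three indices differ. -/
theorem Setoid.top_ne_bot_fin3 : (⊤ : Setoid (Fin 3)) ≠ ⊥ := by
  intro h
  have h1 : (⊤ : Setoid (Fin 3)) 0 1 := trivial
  rw [h] at h1
  exact absurd (show (0 : Fin 3) = 1 from h1) (by decide)

/-- The one-block partition is not a two-block one. -/
theorem top_ne_cross3 (i : Fin 3) : (⊤ : Setoid (Fin 3)) ≠ cross3 i := (cross3_ne_top i).symm

/-- The discrete partition is not a two-block one. -/
theorem bot_ne_cross3 (i : Fin 3) : (⊥ : Setoid (Fin 3)) ≠ cross3 i := (cross3_ne_bot i).symm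

/-- The discrete partition is not the one-block one. -/
theorem Setoid.bot_ne_top_fin3 : (⊥ : Setoid (Fin 3)) ≠ ⊤ := Setoid.top_ne_bot_fin3.symm

/-- Two two-block partitions of three indices are comparable only when equal. -/
theorem cross3_le_cross3_iff {i j : Fin 3} : cross3 i ≤ cross3 j ↔ i = j := by
  constructor
  · intro h
    by_contra hij
    have hinf : cross3 i ⊓ cross3 j = ⊥ := cross3_inf_eq_bot hij
    rw [inf_eq_left.2 h] at hinf
    exact cross3_ne_bot i hinf
  · rintro rfl
    exact le_rfl

/-- The one-block partition is not below a two-block partition. -/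
theorem not_top_le_cross3 (i : Fin 3) : ¬ (⊤ : Setoid (Fin 3)) ≤ cross3 i :=
  fun h => cross3_ne_top i (top_le_iff.1 h)

/-- A two-block partition is not below the discrete partition. -/
theorem not_cross3_le_bot (i : Fin 3) : ¬ cross3 i ≤ (⊥ : Setoid (Fin 3)) :=
  fun h => cross3_ne_bot i (le_bot_iff.1 h)

/-- The one-block partition is not below the discrete one. -/
theorem not_top_le_bot_fin3 : ¬ (⊤ : Setoid (Fin 3)) ≤ (⊥ : Setoid (Fin 3)) :=
  fun h => Setoid.bot_ne_top_fin3 (top_le_iff.1 h)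

/-- A setoid on `Fin 3` relating `0` to `1` but not `0` to `2` is `ab|c = cross3 0`. -/
theorem Setoid.eq_cross3_zero (s : Setoid (Fin 3)) (h01 : s 0 1) (h02 : ¬ s 0 2) :
    s = cross3 0 := by
  have h12 : ¬ s 1 2 := fun h => h02 (s.trans h01 h)
  have h10 : s 1 0 := s.symm h01
  have h20 : ¬ s 2 0 := fun h => h02 (s.symm h)
  have h21 : ¬ s 2 1 := fun h => h12 (s.symm h)
  refine Setoid.ext fun a b => ?_
  rw [cross3_rel]
  fin_cases a <;> fin_cases b <;> simp [h01, h10, h02, h20, h12, h21]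

/-- A setoid on `Fin 3` relating `0` to `2` but not `0` to `1` is `ac|b = cross3 1`. -/
theorem Setoid.eq_cross3_one (s : Setoid (Fin 3)) (h02 : s 0 2) (h01 : ¬ s 0 1) :
    s = cross3 1 := by
  have h12 : ¬ s 1 2 := fun h => h01 (s.trans h02 (s.symm h))
  have h20 : s 2 0 := s.symm h02
  have h10 : ¬ s 1 0 := fun h => h01 (s.symm h)
  have h21 : ¬ s 2 1 := fun h => h12 (s.symm h)
  refine Setoid.ext fun a b => ?_
  rw [cross3_rel]
  fin_cases a <;> fin_cases b <;> simp [h02, h20, h01, h10, h12, h21]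

/-- A setoid on `Fin 3` relating `1` to `2` but not `0` to `1` is `bc|a = cross3 2`. -/
theorem Setoid.eq_cross3_two (s : Setoid (Fin 3)) (h12 : s 1 2) (h01 : ¬ s 0 1) :
    s = cross3 2 := by
  have h02 : ¬ s 0 2 := fun h => h01 (s.trans h (s.symm h12))
  have h21 : s 2 1 := s.symm h12
  have h10 : ¬ s 1 0 := fun h => h01 (s.symm h)
  have h20 : ¬ s 2 0 := fun h => h02 (s.symm h)
  refine Setoid.ext fun a b => ?_
  rw [cross3_rel]
  fin_cases a <;> fin_cases b <;> simp [h12, h21, h01, h10, h02, h20]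

/-- A setoid on `Fin 3` relating no two distinct indices is `⊥`. -/
theorem Setoid.eq_bot_fin3 (s : Setoid (Fin 3)) (h01 : ¬ s 0 1) (h02 : ¬ s 0 2)
    (h12 : ¬ s 1 2) : s = ⊥ := by
  have h10 : ¬ s 1 0 := fun h => h01 (s.symm h)
  have h20 : ¬ s 2 0 := fun h => h02 (s.symm h)
  have h21 : ¬ s 2 1 := fun h => h12 (s.symm h)
  refine Setoid.ext fun a b => ?_
  show s a b ↔ a = b
  fin_cases a <;> fin_cases b <;> simp [h01, h10, h02, h20, h12, h21]

/-- **Classification of the partitions of three indices**: `⊥`, `⊤`, or one of the three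
two-block partitions `cross3 i`. -/
theorem Setoid.fin3_cases (s : Setoid (Fin 3)) : s = ⊥ ∨ s = ⊤ ∨ ∃ i, s = cross3 i := by
  by_cases h01 : s 0 1 <;> by_cases h02 : s 0 2 <;> by_cases h12 : s 1 2
  · exact Or.inr (Or.inl (Setoid.eq_top_of_rel_zero_fin3 s h01 h02))
  · exact Or.inr (Or.inl (Setoid.eq_top_of_rel_zero_fin3 s h01 h02))
  · exact absurd (s.trans h01 h12) h02
  · exact Or.inr (Or.inr ⟨0, Setoid.eq_cross3_zero s h01 h02⟩)
  · exact absurd (s.trans h02 (s.symm h12)) h01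
  · exact Or.inr (Or.inr ⟨1, Setoid.eq_cross3_one s h02 h01⟩)
  · exact Or.inr (Or.inr ⟨2, Setoid.eq_cross3_two s h12 h01⟩)
  · exact Or.inl (Setoid.eq_bot_fin3 s h01 h02 h12)

/-- A strict comparison in the partitions of three indices starts at `⊥` or ends at `⊤`. -/
theorem Setoid.fin3_lt_cases {a b : Setoid (Fin 3)} (h : a < b) :
    (a = ⊥ ∧ ∃ i, b = cross3 i) ∨ (a = ⊥ ∧ b = ⊤) ∨ (∃ i, a = cross3 i ∧ b = ⊤) := by
  rcases Setoid.fin3_cases a with rfl | rfl | ⟨i, rfl⟩ <;>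
    rcases Setoid.fin3_cases b with rfl | rfl | ⟨j, rfl⟩
  · exact absurd h (lt_irrefl _)
  · exact Or.inr (Or.inl ⟨rfl, rfl⟩)
  · exact Or.inl ⟨rfl, j, rfl⟩
  · exact absurd h.le not_top_le_bot_fin3
  · exact absurd h (lt_irrefl _)
  · exact absurd h.le (not_top_le_cross3 j)
  · exact absurd h.le (not_cross3_le_bot i)
  · exact Or.inr (Or.inr ⟨i, rfl, rfl⟩)
  · exact absurd (cross3_le_cross3_iff.1 h.le) (fun hij => h.ne (by rw [hij]))

open Classical in
/-- The pair-sum kernel vanishes on the diagonal. -/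
theorem crossKernel_cross3_self (s : Setoid (Fin 3)) : crossKernel cross3 s s = 0 := by
  unfold crossKernel
  have hx : ∀ i j : Fin 3, (if i ≠ j ∧ s = cross3 i ∧ s = cross3 j then (1 : ℝ) else 0) = 0 := by
    intro i j
    rw [if_neg]
    rintro ⟨hij, h1, h2⟩
    exact hij (cross3_injective (h1.symm.trans h2))
  simp only [hx, Finset.sum_const_zero, sub_zero]
  rcases Setoid.fin3_cases s with rfl | rfl | ⟨i, rfl⟩
  · simp [Setoid.bot_ne_top_fin3]
  · simp [Setoid.top_ne_bot_fin3]
  · simp [cross3_ne_top, cross3_ne_bot]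

/-- The pair-sum kernel at `(⊤, ⊥)`, `(⊥, ⊤)`, `(⊤, ⊤)`, `(⊥, ⊥)`, and at mixed cells. -/
theorem crossKernel_cross3_top_bot : crossKernel cross3 ⊤ ⊥ = 1 := by
  simp [crossKernel, Setoid.top_ne_bot_fin3, Setoid.bot_ne_top_fin3, top_ne_cross3, bot_ne_cross3]

/-- Cross kernel of the three-cell family: the pair `(⊥, ⊤)` has kernel value `1`. -/
theorem crossKernel_cross3_bot_top : crossKernel cross3 ⊥ ⊤ = 1 := by
  simp [crossKernel, Setoid.top_ne_bot_fin3, Setoid.bot_ne_top_fin3, top_ne_cross3, bot_ne_cross3]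

/-- Cross kernel of the three-cell family: `(⊤, cross3 j)` has kernel value `0`. -/
theorem crossKernel_cross3_top_cross (j : Fin 3) : crossKernel cross3 ⊤ (cross3 j) = 0 := by
  simp [crossKernel, Setoid.top_ne_bot_fin3, top_ne_cross3, cross3_ne_top, cross3_ne_bot]

/-- Cross kernel of the three-cell family: `(cross3 i, ⊤)` has kernel value `0`. -/
theorem crossKernel_cross3_cross_top (i : Fin 3) : crossKernel cross3 (cross3 i) ⊤ = 0 := by
  simp [crossKernel, Setoid.top_ne_bot_fin3, top_ne_cross3, cross3_ne_top, cross3_ne_bot]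

/-- Cross kernel of the three-cell family: `(⊥, cross3 j)` has kernel value `0`. -/
theorem crossKernel_cross3_bot_cross (j : Fin 3) : crossKernel cross3 ⊥ (cross3 j) = 0 := by
  simp [crossKernel, Setoid.bot_ne_top_fin3, bot_ne_cross3, cross3_ne_top, cross3_ne_bot]

/-- Cross kernel of the three-cell family: `(cross3 i, ⊥)` has kernel value `0`. -/
theorem crossKernel_cross3_cross_bot (i : Fin 3) : crossKernel cross3 (cross3 i) ⊥ = 0 := by
  simp [crossKernel, Setoid.bot_ne_top_fin3, bot_ne_cross3, cross3_ne_top, cross3_ne_bot]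

open Classical in
/-- The pair-sum kernel at two two-block cells: `-1` when distinct, `0` when equal. -/
theorem crossKernel_cross3_cross_cross (i j : Fin 3) :
    crossKernel cross3 (cross3 i) (cross3 j) = if i = j then 0 else -1 := by
  unfold crossKernel
  have hx : ∀ i' j' : Fin 3,
      (if i' ≠ j' ∧ cross3 j = cross3 i' ∧ cross3 i = cross3 j' then (1 : ℝ) else 0) =
        if i' = j ∧ j' = i ∧ i ≠ j then 1 else 0 := by
    intro i' j'
    by_cases h1 : i' = j <;> by_cases h2 : j' = i
    · rw [h1, h2]
      by_cases hij : i = j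
      · simp [hij]
      · simp [hij, Ne.symm hij]
    · have : cross3 i ≠ cross3 j' := fun h => h2 (cross3_injective h).symm
      simp [h1, h2, this]
    · have : cross3 j ≠ cross3 i' := fun h => h1 (cross3_injective h).symm
      simp [h1, h2, this]
    · have : cross3 j ≠ cross3 i' := fun h => h1 (cross3_injective h).symm
      simp [h1, h2, this]
  simp only [hx, cross3_ne_top, cross3_ne_bot, false_and, if_false, zero_add, zero_sub]
  by_cases hij : i = j
  · subst hij
    simp
  · rw [if_neg hij, Finset.sum_eq_single j]
    · rw [Finset.sum_eq_single i]
      · simp [hij]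
      · intro b _ hb
        simp [hb]
      · simp
    · intro b _ hb
      refine Finset.sum_eq_zero fun b' _ => ?_
      simp [hb]
    · simp

/-- **The pair-sum kernel is SMC on all comparable pairs of `Setoid (Fin 3)`**: its second
difference along any two comparable pairs is nonpositive (jumps `⊥ < ⊤` included). -/
theorem crossKernel_cross3_second_difference (a b a' b' : Setoid (Fin 3)) (hab : a ≤ b)
    (hab' : a' ≤ b') :
    crossKernel cross3 b b' - crossKernel cross3 b a' - crossKernel cross3 a b' +
      crossKernel cross3 a a' ≤ 0 := by
  rcases eq_or_lt_of_le hab with rfl | hab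
  · linarith
  rcases eq_or_lt_of_le hab' with rfl | hab'
  · linarith
  rcases Setoid.fin3_lt_cases hab with ⟨rfl, i, rfl⟩ | ⟨rfl, rfl⟩ | ⟨i, rfl, rfl⟩ <;>
    rcases Setoid.fin3_lt_cases hab' with ⟨rfl, j, rfl⟩ | ⟨rfl, rfl⟩ | ⟨j, rfl, rfl⟩ <;>
    simp only [crossKernel_cross3_top_bot, crossKernel_cross3_bot_top, crossKernel_cross3_top_cross,
      crossKernel_cross3_cross_top, crossKernel_cross3_bot_cross, crossKernel_cross3_cross_bot,
      crossKernel_cross3_cross_cross, crossKernel_cross3_self] <;>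
    (try split_ifs) <;> norm_num

/-- **Lemma B at `k = 3` is a theorem** (the lead's testbed, three-type case included): for every
finite cube and every monotone map `c` into the partitions of three indices, the antipodal pairs
carrying two distinct two-block cells are at most the antipodal pairs of type `{⊤, ⊥}`. Proof: the
antipodal SMC principle for the pair-sum kernel. -/
theorem LemmaB3Abstract_holds : LemmaB3Abstract := by
  intro S _ _ c hc
  have h := sum_kernel_compl_nonneg hc (crossKernel cross3)
    (fun s => le_of_eq (crossKernel_cross3_self s).symm) crossKernel_cross3_second_difference
  rw [sum_crossKernel_compl cross3_injective] at h
  have h' : (crossCount cross3 c : ℝ) ≤ topBotCount c := by linarith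
  exact_mod_cast h'

/-- **The abstract C-004 holds** (any product measure, any monotone map into `Part(3)`). -/
theorem C004abstract_holds : C004abstract := C004abstract_of_LemmaB3Abstract LemmaB3Abstract_holds

/-- **C-004 by the antipodal route** — a second proof of the pair-sum inequality, through Lemma B
at `k = 3`. -/
theorem C004_holds_antipodal : C004 := C004_of_LemmaB3Abstract LemmaB3Abstract_holds

end Fin3

/-! ### Marked partitions: every SMC kernel has nonnegative antipodal sums on every sub-cube -/

namespace MultiGraph

variable {V E : Type*} (G : MultiGraph V E) [Fintype E] [DecidableEq E]

/-- **Antipodal sums of SMC kernels on sub-cubes**: for `k` marked vertices of a finite multigraph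
and a kernel `A` in the SMC cone, the kernel summed over the antipodal pairs of every sub-cube of
edge states (the other edges fixed) is nonnegative — the hypothesis `hbase` of
`quadForm_nonneg_of_antipodal`, now a theorem. -/
theorem antipodal_criterion_of_smc {k : ℕ} (m : Fin k → V)
    {A : Setoid (Fin k) → Setoid (Fin k) → ℝ} (hA : SMC A) (S : Finset E) (ω₀ : Config E) :
    0 ≤ ∑ σ : Config E, A (G.markedPartition (patch S σ ω₀) m)
      (G.markedPartition (patch S (flipOn S σ) ω₀) m) :=
  antipodal_criterion_of_second_difference
    (fun ω ω' => A (G.markedPartition ω m) (G.markedPartition ω' m))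
    (fun _ => hA.diag_nonneg _) (fun e η η' => G.smc_second_difference_nonpos m hA e η η') S ω₀

/-- **The antipodal sum of an SMC kernel at the marked partition**: `Σ_σ A(Π(σ), Π(σᶜ)) ≥ 0`. -/
theorem sum_compl_nonneg_of_smc {k : ℕ} (m : Fin k → V)
    {A : Setoid (Fin k) → Setoid (Fin k) → ℝ} (hA : SMC A) :
    0 ≤ ∑ σ : Config E, A (G.markedPartition σ m) (G.markedPartition σᶜ m) :=
  sum_compl_nonneg_of_second_difference
    (fun ω ω' => A (G.markedPartition ω m) (G.markedPartition ω' m))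
    (fun _ => hA.diag_nonneg _) (fun e η η' => G.smc_second_difference_nonpos m hA e η η')

end MultiGraph

end PercRepro

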